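import Literature.MathematicalPhysics.QuantumFieldTheory.Balaban1983to89.B11HKernelHasMajConcrete
import Literature.MathematicalPhysics.QuantumFieldTheory.Balaban1983to89.B11Ineq189Census

/-!
# `Balaban1983to89.B11Ineq189DressingConcrete` — T. Bałaban, *The variational problem and background fields in renormalization group method for lattice gauge theories*, Commun. Math. Phys. **102** (1985) 277–309 [Balaban1985Variational], pp. 288–292 and p. 308: THE DRESSING OPERATORS `H𝔇(A′)` AND `U′ = I − H𝔇(A′)` OF THE (189) CENSUS HAVE THEIR BLOCK MAJORANTS AT THE CONCRETE `C_j` (rate `½δ₀`), from (73) and the H-kernel letter; the census row T4.1″ and the δ𝔇-shape letters `hR`∕`hU′` consume them by name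

statement-level skeleton of published theorems with citation tags; proofs where landed; nothing here is a claim about the Yang–Mills mass gap

PDF held: `paper:balaban1985-cmp102-variational-background` (journal page = PDF page + 276); (47) p. 285, (66)–(69) p. 288, (73) p. 289,
(90) p. 291, (189) p. 308 read by this seat; displays in the render-verified transcriptions of `B11Eq63FunctionalDerivative` ((66)–(69)),
`B11Eq73KernelConcrete` ((73)), `B11Eq85FirstDerivative` ((90)), `B11Ineq189` ((189)).

CITATION HEADER (lean-in-tree rule 2026-08-18).  WHAT IS REPRODUCED: no new printed statement.  Cell census of (189)
(`SECOND-DERIVATIVE-189.md` §4 U1, the MAJORANTS OF THE FIXED OPERATORS): *«U′ = I − H𝔇: (1 + κB₀·O(1)C₃ε₃·c₁)e^{−½δ₀d} ((46)∕(69)-kernel of H at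
δ_H ≥ ½δ₀ + ⅛δ₀ composed with (73) at ½δ₀, margin from H; `hasMaj_comp_exp`); H𝔇: κB₀O(1)C₃ε₃c₁·e^{−½δ₀d} likewise»* — the dressing `δA″ =
U′δA′` of `A″ = A′ − HD(A′)` ((47), (90) second line: *«(δ∕δA′(b)) V′₀(A′ − HD(A′)) = Σ_{p∈st(b)} ((∂∕∂A(b))V′₀)(A′ − HD(A′), ∂p) − 𝔇*(A′)H* Σ …»*)
that multiplies every local leaf of the census in the 𝔄-slot (rows T4.1″ `B11Ineq189Census.termT41`, T5.L″ `termT5L`; the letters `hR`, `hU′` of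
`B11Ineq189.d2D_shape`).  THIS FILE supplies both majorants AT THE CONCRETE `C_j` of `B11Prop3Concrete` from the tree's concrete (73)
(`B11Ineq73HasMajConcrete.hasMaj_fderiv_Dfix`, rate `½δ₀`) and the H-kernel letter (`B11HKernelHasMajConcrete.hasMaj_H_of_kernel`, rate `δ₀`)
by [3]'s composition rule with the row sum of Lemma 2.1 at rate `½δ₀` (`B11SectG.hasMaj_comp_exp`, `rowSum_cubeGeometry`).

WHAT IS CERTIFIED (kernel, sorry-free; axioms `propext` ∕ `Classical.choice` ∕ `Quot.sound`).
§1 (generic) **`hasMaj_id_supSize`** — the IDENTITY-LOCALITY of the sup sizes with sharp boxes: on any geometry whose distance vanishes on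
   the diagonal, `id` has the majorant `1·e^{−ρd}` at EVERY rate `ρ` (the letters `hI`∕`hA` of `B11Ineq189.hasMaj₂_local` ∕ `d2D_shape`);
   `hasMaj_id_cube` (the cube geometry: `|y − y|₁ = 0`).
§2 **`hasMaj_HD_concrete`** — `H𝔇(A′) = H ∘ (δ∕δA′)D(A′)` has the majorant `(dB₁e^{dδ₀})·θ_D·c₀(δ₀,½)ᵈ·e^{−½δ₀|y − y′|₁}` between the fine
   sup sizes (every `‖A′‖ < ε` of the (73) regime); **`hasMaj_Uprime_concrete`** — `U′ = I − H𝔇(A′)` has the majorant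
   `(1 + (dB₁e^{dδ₀})·θ_D·c₀(δ₀,½)ᵈ)·e^{−½δ₀|y − y′|₁}` — the census's «(1 + κB₀·O(1)C₃ε₃·c₁)e^{−½δ₀d}» with every constant explicit
   (`θ_D = d·e^{½dδ₀}(1 − q)⁻¹e^{dδ₀}C₃(Lʲ)²·2ε` carries the printed ε₃).
§3 **`termT41_concrete_dressing`** — the census row T4.1″ `B11Ineq189Census.termT41` with its dressing letter `hU` DISCHARGED at the concrete
   `C_j`: for ANY local leaf `Leaf` with majorant `β·e^{−½δ₀d}` from the fine sup size (e.g. the `∂²V′₀` leaf once presented on this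
   carrier), `Leaf ∘ U′` is a (189)-term of rate `¼δ₀` and constant `β·(1 + …)·c₀(δ₀,⅛)ᵈ`.

HONEST SCOPE.  (i) Letters only: nothing of (189)'s assembly is claimed; `hHker` ([5] Thm 3.12 kernel form) stays a hypothesis; the regime
hypotheses are those of `hasMaj_fderiv_Dfix` verbatim.  (ii) Single scale `Λ_j`, [5]'s abstract carrier (DIVERGENCE D-pv27.4 inherited); the
constants `d·e^{dδ₀}`, `c₀(δ₀,½)ᵈ`, `c₀(δ₀,⅛)ᵈ` are explicit witnesses of print's «O(1)»∕«c₁».  (iii) Nothing of Propositions 3–9, Theorem 1,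
(B) UV stability or any summit statement is asserted; NOT summit progress.  No `def`, no new named fact; theorem-only module.  Unit
`pub-ymgap-dag-n07-b-g0` (cell `pub-ymgap`, YM-DAG node N07 = [B11], -b₁ seat; count-neutral junction module per dag-lead [DAGLEAD-ME-7-N07-CLOSED]).
Imports `B11HKernelHasMajConcrete`, `B11Ineq189Census` ONLY; modifies nothing there.
-/

noncomputable section

open scoped BigOperators
open Finset

namespace Literature.MathematicalPhysics.QuantumFieldTheory.Balaban1983to89.B11Ineq189DressingConcrete

open Literature.MathematicalPhysics.QuantumFieldTheory.Balaban1983to89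
open B6RandomWalk B11SectG B11SupSize190 B11Ineq189 B11Ineq189Census B11Ineq73HasMajConcrete B11HKernelHasMajConcrete

/-! ## §1 The identity-locality of the sup sizes -/

section Identity

variable {g : B6.Geometry} [DecidableEq g.Site] {X₁ : Type} [Fintype X₁] {E₁ : Type} [NormedAddCommGroup E₁] [NormedSpace ℝ E₁]

/-- **IDENTITY-LOCALITY OF THE SUP SIZE** (sharp boxes `Δ(y) = {x : blk x = y}`): on a geometry whose distance vanishes on the diagonal, the
identity has the majorant `1·e^{−ρ|·|}` at every rate `ρ` — a field localised in the block `y′` has size `0` in every other block. This is the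
letter `hI`∕`hA` («identity-locality of the size») of `B11Ineq189.hasMaj₂_local` ∕ `d2D_shape`. [cite: Balaban1984PropagatorsII, (2.51) p.232]
[cite: Balaban1985Variational, (189) p.308] -/
theorem hasMaj_id_supSize (blk₁ : X₁ → g.Site) (hdiag : ∀ y : g.Site, g.dist y y = 0) (ρ : ℝ) :
    HasMaj (supSize g (fun y => univ.filter fun x => blk₁ x = y) blk₁ : BlockNorm g (X₁ → E₁))
      (supSize g (fun y => univ.filter fun x => blk₁ x = y) blk₁ : BlockNorm g (X₁ → E₁)) LinearMap.id
      (fun y y' => 1 * Real.exp (-(ρ * g.dist y y'))) := by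
  intro y' μ hμ y
  have hμ' : ∀ x, blk₁ x ≠ y' → μ x = 0 := (supSize_isLoc_iff y' μ).1 hμ
  beta_reduce
  rw [LinearMap.id_apply]
  by_cases hy : y = y'
  · subst hy
    rw [hdiag, mul_zero, neg_zero, Real.exp_zero, one_mul, one_mul]
  · have h0 : (supSize g (fun y => univ.filter fun x => blk₁ x = y) blk₁ : BlockNorm g (X₁ → E₁)).loc y μ ≤ 0 :=
      loc_le_of_forall le_rfl fun x hx => by
        have hx' : blk₁ x = y := (Finset.mem_filter.1 hx).2
        rw [hμ' x (by rw [hx']; exact hy), norm_zero]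
    exact h0.trans (mul_nonneg (by positivity)
      ((supSize g (fun y => univ.filter fun x => blk₁ x = y) blk₁ : BlockNorm g (X₁ → E₁)).loc_nonneg y' μ))

end Identity

/-! ## §2 The dressing operators `H𝔇(A′)` and `U′ = I − H𝔇(A′)` at the concrete `C_j` -/

section Concrete

open B7Prop1Explicit B7Prop1Local B7Prop2Explicit B7Prop3Flat B7Prop4Flat B7Eq92Concrete B7Prop3GeneralLinear
  B7Prop4GeneralLevels B7Prop5GeneralOperators B7Prop5GeneralInduction B7Prop5GeneralLevels B7Prop5General B7Ineq149Pairing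
  B13Contraction113 B11Eq44Concrete B11Prop3Model

variable {d : ℕ} {𝔸 : Type} [NormedRing 𝔸] [NormedAlgebra ℂ 𝔸] [CompleteSpace 𝔸] [NormOneClass 𝔸]

omit [CompleteSpace 𝔸] [NormOneClass 𝔸] in
/-- The cube geometry's distance vanishes on the diagonal (`|y − y|₁ = 0`), so `hasMaj_id_supSize` applies to both sup sizes of the (73)∕(190)
files at every rate. [folklore] [cite: Balaban1985Variational, (73) p.289] -/
theorem hasMaj_id_cube (L j : ℕ) (S T : Finset (B7Prop1Explicit.Site d × Fin d)) (ρ : ℝ) :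
    HasMaj (supSize (cubeGeometry L j S T) (boxS L j S T) (blkS L j S T) : BlockNorm (cubeGeometry L j S T) (S → 𝔸))
      (supSize (cubeGeometry L j S T) (boxS L j S T) (blkS L j S T) : BlockNorm (cubeGeometry L j S T) (S → 𝔸)) LinearMap.id
      (fun y y' => 1 * Real.exp (-(ρ * (cubeGeometry L j S T).dist y y'))) :=
  hasMaj_id_supSize (E₁ := 𝔸) (blkS L j S T) (fun y => by simp [B7Prop1Explicit.l1]) ρ

variable (L : ℕ) (hL : 2 ≤ L) {G : Subgroup 𝔸ˣ} (hG : AvgClosed d L G) (k : ℕ)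
  (U₀ : B7Prop1Explicit.Site d → Fin d → 𝔸ˣ) (hU₀ : ∀ x κ, U₀ x κ ∈ G) {α₀ : ℝ} (hα : 0 < α₀)
  (hα3 : C0 d * α₀ ≤ 1 / 3) (hα4 : 4 * α₀ ≤ c2' d L) (h52 : pdev U₀ < α₀ * (((L : ℝ) ^ k)⁻¹) ^ 2)
  {b : ℝ} (hb : 0 < b)
  (hsmall : Real.exp (4 * (800 * ((d : ℝ) + 1) ^ 2 * ((d : ℝ) + 4)) * α₀)
    * (1 + 8 * (131072 * ((d : ℝ) + 1) ^ 2) * ((L : ℝ) ^ k * b)) ≤ 2)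
  (hc₃ : 4 * ((L : ℝ) ^ k * b) < c3 d L)
  (h145 : 8 * d * thetaGen d L α₀ * (L : ℝ)⁻¹ ^ 4 ≤ 1)
  (h155 : (2 * (L : ℝ) - 1) * (L : ℝ)⁻¹ ^ 2 + 2 * d * thetaGen d L α₀ * (L : ℝ)⁻¹ ^ 3
    + 1 / 8 * (1 + 2 * d * thetaGen d L α₀ * (L : ℝ)⁻¹ ^ 2 + 2 * d * C3Gen d L * ((L : ℝ) ^ k * b)) * (L : ℝ)⁻¹ ^ 2 ≤ 1)
  (S T : Finset (B7Prop1Explicit.Site d × Fin d)) (H : (T → 𝔸) →L[ℂ] (S → 𝔸)) {B₀ B₁ δ₀ ε : ℝ}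

include hL hG hU₀ hα hα3 hα4 h52 hb hsmall hc₃ h145 h155 in
/-- **`H𝔇(A′)` AT THE CONCRETE `C_j`** — the fixed operator `H ∘ (δ∕δA′)D(A′)` of the dressing (census U1: *«H𝔇: κB₀O(1)C₃ε₃c₁·e^{−½δ₀d}»*):
(73) (`hasMaj_fderiv_Dfix`, fine → coarse, rate `½δ₀`, constant `θ_D`) followed by `H` (`hasMaj_H_of_kernel`, coarse → fine, rate `δ₀`, constant
`dB₁e^{dδ₀}`), composed by [3]'s rule with the Lemma 2.1 row sum at rate `½δ₀` (margin from `H`): majorant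
`1·(dB₁e^{dδ₀})·θ_D·c₀(δ₀,½)ᵈ·e^{−½δ₀|y − y′|₁}` between the fine sup sizes, at every `‖A′‖ < ε`.
[cite: Balaban1985Variational, (47) p.285, (73) p.289, (189) p.308] [cite: Balaban1984PropagatorsII, (2.52)–(2.56) pp.232–233, Lemma 2.1 p.234] -/
theorem hasMaj_HD_concrete {j : ℕ} (hj : j ≤ k) (hB₀ : 0 ≤ B₀) (hH : ∀ X, ‖H X‖ ≤ B₀ * ‖X‖)
    (hq9 : 9 * ((8 * (131072 * ((d : ℝ) + 1) ^ 2) * Real.exp (4 * (800 * ((d : ℝ) + 1) ^ 2 * ((d : ℝ) + 4)) * α₀))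
      * ((L : ℝ) ^ j) ^ 2) * B₀ * ε < 1) (hε3 : 3 * ε < b)
    (hδ₀ : 0 < δ₀) (hB₁ : 0 ≤ B₁)
    (hHker : ∀ (c'' : T) (Y : 𝔸) (s : S),
      ‖H (Pi.single c'' Y) s‖ ≤ B₁ * Real.exp (-(δ₀ * ((B7Prop1Explicit.l1 (loK L j c''.1.1 - s.1.1) : ℝ) / (L : ℝ) ^ j))) * ‖Y‖)
    (hq : (C3Gen d L * (((L : ℝ) ^ j) ^ 2 * (2 * ε)) * (2 * d) * B₁ * Real.exp (2 * d * δ₀)) * (d * B6.c0 δ₀ (1 / 2) ^ d) < 1)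
    (hε : 0 ≤ ε) {A' : S → 𝔸} (hA : ‖A'‖ < ε) :
    HasMaj (supSize (cubeGeometry L j S T) (boxS L j S T) (blkS L j S T) : BlockNorm (cubeGeometry L j S T) (S → 𝔸))
      (supSize (cubeGeometry L j S T) (boxS L j S T) (blkS L j S T) : BlockNorm (cubeGeometry L j S T) (S → 𝔸))
      ((H.restrictScalars ℝ : (T → 𝔸) →ₗ[ℝ] (S → 𝔸)) ∘ₗ
        ((fderiv ℂ (Dfix (Cmap L U₀ S T j) (H : (T → 𝔸) →ₗ[ℂ] (S → 𝔸))
          ((8 * (131072 * ((d : ℝ) + 1) ^ 2) * Real.exp (4 * (800 * ((d : ℝ) + 1) ^ 2 * ((d : ℝ) + 4)) * α₀)) *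
            ((L : ℝ) ^ j) ^ 2)) A').restrictScalars ℝ : (S → 𝔸) →ₗ[ℝ] (T → 𝔸)))
      (fun y y' => 1 * (d * B₁ * Real.exp (d * δ₀)) *
          (d * Real.exp (1 / 2 * d * δ₀) *
            ((1 - (C3Gen d L * (((L : ℝ) ^ j) ^ 2 * (2 * ε)) * (2 * d) * B₁ * Real.exp (2 * d * δ₀)) *
                (d * B6.c0 δ₀ (1 / 2) ^ d))⁻¹ * (Real.exp (d * δ₀) * (C3Gen d L * ((L : ℝ) ^ j) ^ 2 * (2 * ε))))) *
        (B6.c0 δ₀ (1 / 2) ^ d) * Real.exp (-(δ₀ / 2 * (cubeGeometry L j S T).dist y y'))) := by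
  have hL1 : 1 ≤ L := le_trans (by norm_num) hL
  have h73 := hasMaj_fderiv_Dfix L hL hG k U₀ hU₀ hα hα3 hα4 h52 hb hsmall hc₃ h145 h155 S T H hj hB₀ hH hq9 hε3 hδ₀ hB₁ hHker hq
    hε hA
  have hHm := hasMaj_H_of_kernel hL1 j S T H hB₁ hδ₀.le hHker
  have hQ1 : 0 < 1 - (C3Gen d L * (((L : ℝ) ^ j) ^ 2 * (2 * ε)) * (2 * d) * B₁ * Real.exp (2 * d * δ₀)) *
      (d * B6.c0 δ₀ (1 / 2) ^ d) := by linarith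
  have hC3 : 0 ≤ C3Gen d L := by unfold C3Gen C1ppGen; positivity
  have hθD : 0 ≤ d * Real.exp (1 / 2 * d * δ₀) *
      ((1 - (C3Gen d L * (((L : ℝ) ^ j) ^ 2 * (2 * ε)) * (2 * d) * B₁ * Real.exp (2 * d * δ₀)) *
          (d * B6.c0 δ₀ (1 / 2) ^ d))⁻¹ * (Real.exp (d * δ₀) * (C3Gen d L * ((L : ℝ) ^ j) ^ 2 * (2 * ε)))) :=
    mul_nonneg (by positivity) (mul_nonneg (inv_nonneg.2 hQ1.le) (by positivity))
  have hrow : RowSum (cubeGeometry L j S T) (δ₀ / 2) (B6.c0 δ₀ (1 / 2) ^ d) := by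
    have h2 : δ₀ / 2 = 1 / 2 * δ₀ := by ring
    rw [h2]
    exact rowSum_cubeGeometry L j S T (by positivity)
  have key := hasMaj_comp_exp (triangle254_cubeGeometry L j S T) (dist_nonneg_cubeGeometry L j S T) hrow
    (by positivity : 0 ≤ (d : ℝ) * B₁ * Real.exp (d * δ₀)) hθD (by positivity : 0 ≤ δ₀ / 2) le_rfl (by linarith : δ₀ / 2 + δ₀ / 2 ≤ δ₀)
    hHm h73
  simpa only [supSize_κ] using key

include hL hG hU₀ hα hα3 hα4 h52 hb hsmall hc₃ h145 h155 in
/-- **`U′ = I − H𝔇(A′)` AT THE CONCRETE `C_j`** — the dressing of the variation `δA″ = U′δA′` of `A″ = A′ − HD(A′)` ((47); the `𝔄`-slot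
factor of every local leaf in the census, rows T4.1″∕T5.L″; letters `hU′` of `B11Ineq189.d2D_shape`): the identity-locality (§1) plus
`hasMaj_HD_concrete` give the census's majorant «(1 + κB₀·O(1)C₃ε₃·c₁)e^{−½δ₀d}» with explicit constants,
`(1 + (dB₁e^{dδ₀})·θ_D·c₀(δ₀,½)ᵈ)·e^{−½δ₀|y − y′|₁}`, at every `‖A′‖ < ε`. [cite: Balaban1985Variational, (47) p.285, (90) p.291, (189) p.308]
[cite: Balaban1984PropagatorsII, (2.52)–(2.56) pp.232–233] -/
theorem hasMaj_Uprime_concrete {j : ℕ} (hj : j ≤ k) (hB₀ : 0 ≤ B₀) (hH : ∀ X, ‖H X‖ ≤ B₀ * ‖X‖)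
    (hq9 : 9 * ((8 * (131072 * ((d : ℝ) + 1) ^ 2) * Real.exp (4 * (800 * ((d : ℝ) + 1) ^ 2 * ((d : ℝ) + 4)) * α₀))
      * ((L : ℝ) ^ j) ^ 2) * B₀ * ε < 1) (hε3 : 3 * ε < b)
    (hδ₀ : 0 < δ₀) (hB₁ : 0 ≤ B₁)
    (hHker : ∀ (c'' : T) (Y : 𝔸) (s : S),
      ‖H (Pi.single c'' Y) s‖ ≤ B₁ * Real.exp (-(δ₀ * ((B7Prop1Explicit.l1 (loK L j c''.1.1 - s.1.1) : ℝ) / (L : ℝ) ^ j))) * ‖Y‖)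
    (hq : (C3Gen d L * (((L : ℝ) ^ j) ^ 2 * (2 * ε)) * (2 * d) * B₁ * Real.exp (2 * d * δ₀)) * (d * B6.c0 δ₀ (1 / 2) ^ d) < 1)
    (hε : 0 ≤ ε) {A' : S → 𝔸} (hA : ‖A'‖ < ε) :
    HasMaj (supSize (cubeGeometry L j S T) (boxS L j S T) (blkS L j S T) : BlockNorm (cubeGeometry L j S T) (S → 𝔸))
      (supSize (cubeGeometry L j S T) (boxS L j S T) (blkS L j S T) : BlockNorm (cubeGeometry L j S T) (S → 𝔸))
      (LinearMap.id - (H.restrictScalars ℝ : (T → 𝔸) →ₗ[ℝ] (S → 𝔸)) ∘ₗ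
        ((fderiv ℂ (Dfix (Cmap L U₀ S T j) (H : (T → 𝔸) →ₗ[ℂ] (S → 𝔸))
          ((8 * (131072 * ((d : ℝ) + 1) ^ 2) * Real.exp (4 * (800 * ((d : ℝ) + 1) ^ 2 * ((d : ℝ) + 4)) * α₀)) *
            ((L : ℝ) ^ j) ^ 2)) A').restrictScalars ℝ : (S → 𝔸) →ₗ[ℝ] (T → 𝔸)))
      (fun y y' => (1 + (d * B₁ * Real.exp (d * δ₀)) *
          (d * Real.exp (1 / 2 * d * δ₀) *
            ((1 - (C3Gen d L * (((L : ℝ) ^ j) ^ 2 * (2 * ε)) * (2 * d) * B₁ * Real.exp (2 * d * δ₀)) *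
                (d * B6.c0 δ₀ (1 / 2) ^ d))⁻¹ * (Real.exp (d * δ₀) * (C3Gen d L * ((L : ℝ) ^ j) ^ 2 * (2 * ε))))) *
          (B6.c0 δ₀ (1 / 2) ^ d)) * Real.exp (-(δ₀ / 2 * (cubeGeometry L j S T).dist y y'))) := by
  have hHD := hasMaj_HD_concrete L hL hG k U₀ hU₀ hα hα3 hα4 h52 hb hsmall hc₃ h145 h155 S T H hj hB₀ hH hq9 hε3 hδ₀ hB₁ hHker hq hε hA
  have hid := hasMaj_id_cube (𝔸 := 𝔸) L j S T (δ₀ / 2)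
  exact (hid.sub hHD).mono fun y y' => le_of_eq (by ring)

/-! ## §3 The census row T4.1″ with its dressing letter discharged -/

include hL hG hU₀ hα hα3 hα4 h52 hb hsmall hc₃ h145 h155 in
/-- **T4.1″ AT THE CONCRETE DRESSING** — `B11Ineq189Census.termT41` (`Ξ[𝔄] = Leaf ∘ U′`) with `hU := hasMaj_Uprime_concrete`: for ANY local
leaf `Leaf` from the fine sup size into any size `b₃` with majorant `β·e^{−½δ₀d}` (the `∂²V′₀` leaf of `B11Eq90V0primeSecondDerivative` once
presented on this carrier, or the commutator forms of T5.L″), `Leaf ∘ U′` is a (189)-term with the rate `¼δ₀` and the constant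
`1·β·(1 + (dB₁e^{dδ₀})θ_Dc₀(δ₀,½)ᵈ)·c₀(δ₀,⅛)ᵈ` — the row's «κ·β·a_{U′}·c» at concrete letters. [cite: Balaban1985Variational, (90) p.291, (189) p.308] -/
theorem termT41_concrete_dressing {j : ℕ} (hj : j ≤ k) (hB₀ : 0 ≤ B₀) (hH : ∀ X, ‖H X‖ ≤ B₀ * ‖X‖)
    (hq9 : 9 * ((8 * (131072 * ((d : ℝ) + 1) ^ 2) * Real.exp (4 * (800 * ((d : ℝ) + 1) ^ 2 * ((d : ℝ) + 4)) * α₀))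
      * ((L : ℝ) ^ j) ^ 2) * B₀ * ε < 1) (hε3 : 3 * ε < b)
    (hδ₀ : 0 < δ₀) (hB₁ : 0 ≤ B₁)
    (hHker : ∀ (c'' : T) (Y : 𝔸) (s : S),
      ‖H (Pi.single c'' Y) s‖ ≤ B₁ * Real.exp (-(δ₀ * ((B7Prop1Explicit.l1 (loK L j c''.1.1 - s.1.1) : ℝ) / (L : ℝ) ^ j))) * ‖Y‖)
    (hq : (C3Gen d L * (((L : ℝ) ^ j) ^ 2 * (2 * ε)) * (2 * d) * B₁ * Real.exp (2 * d * δ₀)) * (d * B6.c0 δ₀ (1 / 2) ^ d) < 1)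
    (hε : 0 ≤ ε) {A' : S → 𝔸} (hA : ‖A'‖ < ε)
    {F₃ : Type} [AddCommGroup F₃] [Module ℝ F₃] {b₃ : BlockNorm (cubeGeometry L j S T) F₃}
    {Leaf : (S → 𝔸) →ₗ[ℝ] F₃} {β : ℝ} (hβ : 0 ≤ β)
    (hLeaf : HasMaj (supSize (cubeGeometry L j S T) (boxS L j S T) (blkS L j S T) : BlockNorm (cubeGeometry L j S T) (S → 𝔸)) b₃
      Leaf (fun y y' => β * Real.exp (-(δ₀ / 2 * (cubeGeometry L j S T).dist y y')))) :
    HasMaj (supSize (cubeGeometry L j S T) (boxS L j S T) (blkS L j S T) : BlockNorm (cubeGeometry L j S T) (S → 𝔸)) b₃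
      (Leaf ∘ₗ (LinearMap.id - (H.restrictScalars ℝ : (T → 𝔸) →ₗ[ℝ] (S → 𝔸)) ∘ₗ
        ((fderiv ℂ (Dfix (Cmap L U₀ S T j) (H : (T → 𝔸) →ₗ[ℂ] (S → 𝔸))
          ((8 * (131072 * ((d : ℝ) + 1) ^ 2) * Real.exp (4 * (800 * ((d : ℝ) + 1) ^ 2 * ((d : ℝ) + 4)) * α₀)) *
            ((L : ℝ) ^ j) ^ 2)) A').restrictScalars ℝ : (S → 𝔸) →ₗ[ℝ] (T → 𝔸))))
      (fun y y' => 1 * β * (1 + (d * B₁ * Real.exp (d * δ₀)) *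
          (d * Real.exp (1 / 2 * d * δ₀) *
            ((1 - (C3Gen d L * (((L : ℝ) ^ j) ^ 2 * (2 * ε)) * (2 * d) * B₁ * Real.exp (2 * d * δ₀)) *
                (d * B6.c0 δ₀ (1 / 2) ^ d))⁻¹ * (Real.exp (d * δ₀) * (C3Gen d L * ((L : ℝ) ^ j) ^ 2 * (2 * ε))))) *
          (B6.c0 δ₀ (1 / 2) ^ d)) * (B6.c0 δ₀ (1 / 8) ^ d) * Real.exp (-(δ₀ / 4 * (cubeGeometry L j S T).dist y y'))) := by
  have hU := hasMaj_Uprime_concrete L hL hG k U₀ hU₀ hα hα3 hα4 h52 hb hsmall hc₃ h145 h155 S T H hj hB₀ hH hq9 hε3 hδ₀ hB₁ hHker hq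
    hε hA
  have hQ1 : 0 < 1 - (C3Gen d L * (((L : ℝ) ^ j) ^ 2 * (2 * ε)) * (2 * d) * B₁ * Real.exp (2 * d * δ₀)) *
      (d * B6.c0 δ₀ (1 / 2) ^ d) := by linarith
  have hC3 : 0 ≤ C3Gen d L := by unfold C3Gen C1ppGen; positivity
  have hc2 : 0 ≤ B6.c0 δ₀ (1 / 2) ^ d := pow_nonneg (tsum_nonneg fun _ => (Real.exp_pos _).le) d
  have hc8 : 0 ≤ B6.c0 δ₀ (1 / 8) ^ d := pow_nonneg (tsum_nonneg fun _ => (Real.exp_pos _).le) d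
  have haU : 0 ≤ 1 + (d * B₁ * Real.exp (d * δ₀)) *
      (d * Real.exp (1 / 2 * d * δ₀) *
        ((1 - (C3Gen d L * (((L : ℝ) ^ j) ^ 2 * (2 * ε)) * (2 * d) * B₁ * Real.exp (2 * d * δ₀)) *
            (d * B6.c0 δ₀ (1 / 2) ^ d))⁻¹ * (Real.exp (d * δ₀) * (C3Gen d L * ((L : ℝ) ^ j) ^ 2 * (2 * ε))))) *
      (B6.c0 δ₀ (1 / 2) ^ d) :=
    add_nonneg zero_le_one (mul_nonneg (mul_nonneg (by positivity)
      (mul_nonneg (by positivity) (mul_nonneg (inv_nonneg.2 hQ1.le) (by positivity)))) hc2)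
  have hrow : RowSum (cubeGeometry L j S T) (δ₀ / 8) (B6.c0 δ₀ (1 / 8) ^ d) := by
    have h8 : δ₀ / 8 = 1 / 8 * δ₀ := by ring
    rw [h8]
    exact rowSum_cubeGeometry L j S T (by positivity)
  have key := termT41 (bN := (supSize (cubeGeometry L j S T) (boxS L j S T) (blkS L j S T) :
      BlockNorm (cubeGeometry L j S T) (S → 𝔸)))
    (b₁ := (supSize (cubeGeometry L j S T) (boxS L j S T) (blkS L j S T) : BlockNorm (cubeGeometry L j S T) (S → 𝔸)))
    (b₃ := b₃) (triangle254_cubeGeometry L j S T) (dist_nonneg_cubeGeometry L j S T) hδ₀.le hrow haU hβ hU hLeaf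
  simpa only [supSize_κ] using key

end Concrete

end Literature.MathematicalPhysics.QuantumFieldTheory.Balaban1983to89.B11Ineq189DressingConcrete
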